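import Literature.NumberTheory.Sieve.RoughOmegaCellsClassesBVBoxes
import Literature.NumberTheory.Sieve.RoughOmegaCellsClassesBVCounting
import Literature.NumberTheory.Sieve.ElliottHalberstamBridgeProofs
import HarnessLib

/-!
# Bombieri–Vinogradov for the `Ω`-cells of the rough integers, VI: the boundary terms

Topic `Literature/NumberTheory/Sieve`, sub-namespace `RoughCellsAP`.  Everything here is PROVED
and elementary.  In the proof of the averaged equidistribution of the `Ω`-cells of the rough integers
(Motohashi 1976; Bombieri–Friedlander–Iwaniec 1986, Theorem 0 (b)) the pairs `(m, p)` not covered by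
the boxes of `RoughOmegaCellsClassesBVBoxes.lean` (products `≤ X 2^{-I}` or `> X/(1+δ)`) and the
non-squarefree members of the cell are estimated trivially, summed over the moduli `q ≤ Q`:

* `abs_pairDisc_le_card_add` — `|D_q(R)| ≤ #{x ∈ S : congruent} + #S/φ(q)` for `R ⊆ S`;
* `sum_card_rest_filter_modEq_le`, `card_rest_le` — the boundary pairs in a class, summed over `q`,
  are `≤ (j+1)[(X 2^{-I} + δX + 1)(1 + log Q) + 2Q]`, and in total `≤ (j+1)(X 2^{-I} + δX + 1)`;
* `sum_abs_cellClassDisc_le_boxes_add` — MAIN: for `(1+δ)^K > X`,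
  `Σ_{q ≤ Q} |cell discrepancy| ≤ Σ_{k<K, i<I} Σ_{q ≤ Q} |D_q(box (k,i))| + REST` with
  `REST = (j+1)[2 (X 2^{-I} + δX + 1)(1 + log Q)² + 2Q] + ⌊X⌋(1 + log Q)/(N₀ − 1) + Q √X
   + (⌊X⌋/(N₀ − 1) + √X)(1 + log Q)²` (`Σ_{q ≤ Q} 1/φ(q) ≤ (1 + log Q)²`).

## References

* E. Bombieri, J. B. Friedlander, H. Iwaniec, Acta Math. 156 (1986), 203–251, §2.
  [BombieriFriedlanderIwaniecActa1986]
-/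

open Finset
open scoped ArithmeticFunction.Omega

namespace Literature.NumberTheory.Sieve

namespace RoughCellsAP

open BFI

/-! Local notation (as in the companion files). -/
local notation3 (prettyPrint := false) "cellΩ" N₀:max T:max i:max =>
  Finset.filter (fun b : ℕ => ArithmeticFunction.cardFactors b = i) (roughIcc N₀ T)
local notation3 (prettyPrint := false) "primesIn" N₀:max T:max =>
  Finset.filter (fun p : ℕ => Nat.Prime p ∧ N₀ ≤ p) (Finset.Icc 1 T)
local notation3 (prettyPrint := false) "pairs" N₀:max T:max j:max =>
  Finset.filter (fun x : ℕ × ℕ => x.1 * x.2 ≤ T) ((cellΩ N₀ T j) ×ˢ (primesIn N₀ T))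
local notation3 (prettyPrint := false) "boxA" N₀:max T:max j:max δ:max k:max i:max =>
  Finset.filter (fun m : ℕ => BFI.InBox ((1 + δ) ^ k) 1 i m) (cellΩ N₀ T j)
local notation3 (prettyPrint := false) "boxB" N₀:max T:max X:max δ:max k:max =>
  Finset.filter (fun p : ℕ => BFI.InBox X δ k p) (primesIn N₀ T)
local notation3 (prettyPrint := false) "restW" X:max δ:max I:max =>
  (fun x : ℕ × ℕ => ((x.1 * x.2 : ℕ) : ℝ) ≤ X / 2 ^ I ∨ X / (1 + δ) < ((x.1 * x.2 : ℕ) : ℝ))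

/-! ### The discrepancy of a small set of pairs -/

/-- `|D_q(R)| ≤ #{x ∈ S : x₁x₂ ≡ c} + #S/φ(q)` for `R ⊆ S`. [folklore] -/
theorem abs_pairDisc_le_card_add {R S : Finset (ℕ × ℕ)} (hRS : R ⊆ S) {q : ℕ} (hq : 0 < q) (c : ℕ) :
    |(#(R.filter (fun x : ℕ × ℕ => x.1 * x.2 ≡ c [MOD q])) : ℝ) -
        (#(R.filter (fun x : ℕ × ℕ => (x.1 * x.2).Coprime q)) : ℝ) / (Nat.totient q : ℝ)| ≤
      #(S.filter (fun x : ℕ × ℕ => x.1 * x.2 ≡ c [MOD q])) + (#S : ℝ) / (Nat.totient q : ℝ) := by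
  have hφ : (0 : ℝ) < Nat.totient q := by exact_mod_cast Nat.totient_pos.2 hq
  have h1 : (#(R.filter (fun x : ℕ × ℕ => x.1 * x.2 ≡ c [MOD q])) : ℝ) ≤
      #(S.filter (fun x : ℕ × ℕ => x.1 * x.2 ≡ c [MOD q])) := by
    exact_mod_cast Finset.card_le_card (Finset.filter_subset_filter _ hRS)
  have h2 : (#(R.filter (fun x : ℕ × ℕ => (x.1 * x.2).Coprime q)) : ℝ) ≤ #S := by
    exact_mod_cast Finset.card_le_card ((Finset.filter_subset _ _).trans hRS)
  have h3 : (#(R.filter (fun x : ℕ × ℕ => (x.1 * x.2).Coprime q)) : ℝ) / Nat.totient q ≤ #S / Nat.totient q :=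
    div_le_div_of_nonneg_right h2 hφ.le
  have h4 : 0 ≤ (#(R.filter (fun x : ℕ × ℕ => x.1 * x.2 ≡ c [MOD q])) : ℝ) := Nat.cast_nonneg _
  have h5 : 0 ≤ (#(R.filter (fun x : ℕ × ℕ => (x.1 * x.2).Coprime q)) : ℝ) / Nat.totient q := by positivity
  have h6 : 0 ≤ (#(S.filter (fun x : ℕ × ℕ => x.1 * x.2 ≡ c [MOD q])) : ℝ) := Nat.cast_nonneg _
  rw [abs_le]
  constructor <;> linarith

/-! ### The boundary pairs -/

/-- The integers `b ≤ T` with `b ≤ X 2^{-I}` or `b > X/(1+δ)` in a class: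
`≤ (⌊X 2^{-I}⌋/q + 1) + ((T − ⌊X/(1+δ)⌋)/q + 1)` (`T = ⌊X⌋`). [folklore] -/
theorem card_Icc_filter_restW_modEq_le {X δ : ℝ} (hX : 0 ≤ X) (hδ : 0 ≤ δ) (I : ℕ) {q : ℕ} (hq : 0 < q)
    (c : ℕ) :
    (#((Finset.Icc 1 ⌊X⌋₊).filter (fun b : ℕ =>
        ((b : ℝ) ≤ X / 2 ^ I ∨ X / (1 + δ) < (b : ℝ)) ∧ b ≡ c [MOD q])) : ℝ) ≤
      ((⌊X / 2 ^ I⌋₊ : ℝ) / q + 1) + (((⌊X⌋₊ : ℝ) - ⌊X / (1 + δ)⌋₊) / q + 1) := by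
  have hlo : ⌊X / (1 + δ)⌋₊ ≤ ⌊X⌋₊ := Nat.floor_mono (div_le_self hX (by linarith))
  have h0 : 0 ≤ X / (1 + δ) := by positivity
  have hsplit : (Finset.Icc 1 ⌊X⌋₊).filter (fun b : ℕ =>
      ((b : ℝ) ≤ X / 2 ^ I ∨ X / (1 + δ) < (b : ℝ)) ∧ b ≡ c [MOD q]) ⊆
      (Finset.Icc 1 ⌊X / 2 ^ I⌋₊).filter (fun b : ℕ => 0 < b ∧ b ≡ c [MOD q]) ∪
        (Finset.Icc 1 ⌊X⌋₊).filter (fun b : ℕ => ⌊X / (1 + δ)⌋₊ < b ∧ b ≡ c [MOD q]) := by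
    intro b hb
    rw [Finset.mem_filter, Finset.mem_Icc] at hb
    obtain ⟨⟨hb1, hbT⟩, hW, hbc⟩ := hb
    rw [Finset.mem_union, Finset.mem_filter, Finset.mem_filter, Finset.mem_Icc, Finset.mem_Icc]
    rcases hW with h | h
    · exact Or.inl ⟨⟨hb1, Nat.le_floor h⟩, hb1, hbc⟩
    · exact Or.inr ⟨⟨hb1, hbT⟩, (Nat.floor_lt h0).2 h, hbc⟩
  have h1 := card_Icc_filter_modEq_le hq (Nat.zero_le ⌊X / 2 ^ I⌋₊) c
  have h2 := card_Icc_filter_modEq_le hq hlo c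
  rw [Nat.cast_zero, sub_zero] at h1
  calc (#((Finset.Icc 1 ⌊X⌋₊).filter (fun b : ℕ =>
        ((b : ℝ) ≤ X / 2 ^ I ∨ X / (1 + δ) < (b : ℝ)) ∧ b ≡ c [MOD q])) : ℝ)
      ≤ #((Finset.Icc 1 ⌊X / 2 ^ I⌋₊).filter (fun b : ℕ => 0 < b ∧ b ≡ c [MOD q]) ∪
          (Finset.Icc 1 ⌊X⌋₊).filter (fun b : ℕ => ⌊X / (1 + δ)⌋₊ < b ∧ b ≡ c [MOD q])) := by
        exact_mod_cast Finset.card_le_card hsplit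
    _ ≤ #((Finset.Icc 1 ⌊X / 2 ^ I⌋₊).filter (fun b : ℕ => 0 < b ∧ b ≡ c [MOD q])) +
          #((Finset.Icc 1 ⌊X⌋₊).filter (fun b : ℕ => ⌊X / (1 + δ)⌋₊ < b ∧ b ≡ c [MOD q])) := by
        exact_mod_cast Finset.card_union_le _ _
    _ ≤ _ := add_le_add h1 h2

/-- `⌊X⌋ − ⌊X/(1+δ)⌋ ≤ δX + 1`. [folklore] -/
theorem floor_sub_floor_le {X δ : ℝ} (hX : 0 ≤ X) (hδ : 0 ≤ δ) :
    (⌊X⌋₊ : ℝ) - ⌊X / (1 + δ)⌋₊ ≤ δ * X + 1 := by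
  have h1 : (⌊X⌋₊ : ℝ) ≤ X := Nat.floor_le hX
  have h2 : X / (1 + δ) < ⌊X / (1 + δ)⌋₊ + 1 := Nat.lt_floor_add_one _
  have h3 : X - δ * X ≤ X / (1 + δ) := by
    rw [le_div_iff₀ (by linarith)]; nlinarith [mul_nonneg hδ (mul_nonneg hδ hX)]
  linarith

/-- **Boundary pairs in classes, summed over the moduli**:
`Σ_{q ≤ Q} #{(m,p) boundary : mp ≡ c_q (q)} ≤ (j+1)[(X 2^{-I} + δX + 1)(1 + log Q) + 2Q]`.
[folklore] -/
theorem sum_card_rest_filter_modEq_le {N₀ j : ℕ} {X δ : ℝ} (hX : 0 ≤ X) (hδ : 0 ≤ δ) (I Q : ℕ)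
    (c : ℕ → ℕ) :
    ∑ q ∈ Finset.Icc 1 Q, (#(((pairs N₀ ⌊X⌋₊ j).filter (restW X δ I)).filter
        (fun x : ℕ × ℕ => x.1 * x.2 ≡ c q [MOD q])) : ℝ) ≤
      (j + 1) * ((X / 2 ^ I + δ * X + 1) * (1 + Real.log Q) + 2 * Q) := by
  have hkey : ∀ q ∈ Finset.Icc 1 Q, (#(((pairs N₀ ⌊X⌋₊ j).filter (restW X δ I)).filter
      (fun x : ℕ × ℕ => x.1 * x.2 ≡ c q [MOD q])) : ℝ) ≤
      (j + 1) * (((⌊X / 2 ^ I⌋₊ : ℝ) + ((⌊X⌋₊ : ℝ) - ⌊X / (1 + δ)⌋₊)) / q + 2) := by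
    intro q hq
    have hq0 : 0 < q := (Finset.mem_Icc.1 hq).1
    rw [Finset.filter_filter]
    refine (card_pairs_filter_le_Icc (N₀ := N₀) (T := ⌊X⌋₊) (j := j)
      (fun b : ℕ => ((b : ℝ) ≤ X / 2 ^ I ∨ X / (1 + δ) < (b : ℝ)) ∧ b ≡ c q [MOD q])).trans ?_
    refine mul_le_mul_of_nonneg_left ((card_Icc_filter_restW_modEq_le hX hδ I hq0 (c q)).trans (le_of_eq ?_))
      (by positivity)
    rw [add_div]; ring
  refine (Finset.sum_le_sum hkey).trans ?_
  rw [← Finset.mul_sum]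
  refine mul_le_mul_of_nonneg_left ?_ (by positivity)
  have hsub := floor_sub_floor_le hX hδ
  have hlo : (0 : ℝ) ≤ (⌊X⌋₊ : ℝ) - ⌊X / (1 + δ)⌋₊ := by
    have : ⌊X / (1 + δ)⌋₊ ≤ ⌊X⌋₊ := Nat.floor_mono (div_le_self hX (by linarith))
    have : (⌊X / (1 + δ)⌋₊ : ℝ) ≤ ⌊X⌋₊ := by exact_mod_cast this
    linarith
  have ha : (0 : ℝ) ≤ (⌊X / 2 ^ I⌋₊ : ℝ) + ((⌊X⌋₊ : ℝ) - ⌊X / (1 + δ)⌋₊) := by positivity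
  refine (sum_Icc_div_add_le Q ha 2).trans ?_
  have hfl : (⌊X / 2 ^ I⌋₊ : ℝ) ≤ X / 2 ^ I := Nat.floor_le (by positivity)
  have hlog : 0 ≤ 1 + Real.log Q := by
    rcases Nat.eq_zero_or_pos Q with h | h
    · rw [h]; simp
    · have : (1 : ℝ) ≤ Q := by exact_mod_cast h
      have := Real.log_nonneg this; linarith
  nlinarith

/-- **The number of boundary pairs**: `≤ (j+1)(X 2^{-I} + δX + 1)`. [folklore] -/
theorem card_rest_le {N₀ j : ℕ} {X δ : ℝ} (hX : 0 ≤ X) (hδ : 0 ≤ δ) (I : ℕ) :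
    (#((pairs N₀ ⌊X⌋₊ j).filter (restW X δ I)) : ℝ) ≤ (j + 1) * (X / 2 ^ I + δ * X + 1) := by
  have h0 : 0 ≤ X / (1 + δ) := by positivity
  refine (card_pairs_filter_le_Icc (N₀ := N₀) (T := ⌊X⌋₊) (j := j)
    (fun b : ℕ => (b : ℝ) ≤ X / 2 ^ I ∨ X / (1 + δ) < (b : ℝ))).trans ?_
  refine mul_le_mul_of_nonneg_left ?_ (by positivity)
  have hsplit : (Finset.Icc 1 ⌊X⌋₊).filter (fun b : ℕ => (b : ℝ) ≤ X / 2 ^ I ∨ X / (1 + δ) < (b : ℝ)) ⊆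
      Finset.Icc 1 ⌊X / 2 ^ I⌋₊ ∪ Finset.Ioc ⌊X / (1 + δ)⌋₊ ⌊X⌋₊ := by
    intro b hb
    rw [Finset.mem_filter, Finset.mem_Icc] at hb
    rw [Finset.mem_union, Finset.mem_Icc, Finset.mem_Ioc]
    rcases hb.2 with h | h
    · exact Or.inl ⟨hb.1.1, Nat.le_floor h⟩
    · exact Or.inr ⟨(Nat.floor_lt h0).2 h, hb.1.2⟩
  have hlo : ⌊X / (1 + δ)⌋₊ ≤ ⌊X⌋₊ := Nat.floor_mono (div_le_self hX (by linarith))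
  calc (#((Finset.Icc 1 ⌊X⌋₊).filter (fun b : ℕ => (b : ℝ) ≤ X / 2 ^ I ∨ X / (1 + δ) < (b : ℝ))) : ℝ)
      ≤ #(Finset.Icc 1 ⌊X / 2 ^ I⌋₊ ∪ Finset.Ioc ⌊X / (1 + δ)⌋₊ ⌊X⌋₊) := by
        exact_mod_cast Finset.card_le_card hsplit
    _ ≤ #(Finset.Icc 1 ⌊X / 2 ^ I⌋₊) + #(Finset.Ioc ⌊X / (1 + δ)⌋₊ ⌊X⌋₊) := by
        exact_mod_cast Finset.card_union_le _ _
    _ = ⌊X / 2 ^ I⌋₊ + ((⌊X⌋₊ : ℝ) - ⌊X / (1 + δ)⌋₊) := by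
        rw [Nat.card_Icc, Nat.card_Ioc, Nat.add_sub_cancel, Nat.cast_sub hlo]
    _ ≤ X / 2 ^ I + δ * X + 1 := by
        have h1 : (⌊X / 2 ^ I⌋₊ : ℝ) ≤ X / 2 ^ I := Nat.floor_le (by positivity)
        have h2 := floor_sub_floor_le hX hδ
        linarith

/-! ### The cell discrepancy through the boxes and the boundary -/

/-- **The cell discrepancy through the boxes**, summed over the moduli: for `X > 0`, `δ > 0`,
`(1+δ)^K > X`, `N₀ ≥ 2` and reduced classes `c_q`,
`Σ_{q ≤ Q} |Φ-disc_q| ≤ Σ_{(k,i)} Σ_{q ≤ Q} |D_q(box (k,i))|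
  + (j+1)[2 (X 2^{-I} + δX + 1)(1 + log Q)² + 2Q] + ⌊X⌋(1 + log Q)/(N₀ − 1) + Q √⌊X⌋
  + (⌊X⌋/(N₀ − 1) + √⌊X⌋)(1 + log Q)²`. [folklore] -/
theorem sum_abs_cellClassDisc_le_boxes_add {N₀ j : ℕ} (hN₀ : 2 ≤ N₀) {X δ : ℝ} (hX : 0 < X)
    (hδ : 0 < δ) {K : ℕ} (hK : X < (1 + δ) ^ K) (I Q : ℕ)
    {c : ℕ → ℕ} (hc : ∀ q : ℕ, 0 < q → (c q).Coprime q) :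
    ∑ q ∈ Finset.Icc 1 Q,
        |(#((cellΩ N₀ ⌊X⌋₊ (j + 1)).filter (fun b : ℕ => b ≡ c q [MOD q])) : ℝ) -
          (#((cellΩ N₀ ⌊X⌋₊ (j + 1)).filter (fun b : ℕ => b.Coprime q)) : ℝ) / (Nat.totient q : ℝ)| ≤
      (∑ ki ∈ Finset.range K ×ˢ Finset.range I, ∑ q ∈ Finset.Icc 1 Q,
        |(#(((boxA N₀ ⌊X⌋₊ j δ ki.1 ki.2) ×ˢ (boxB N₀ ⌊X⌋₊ X δ ki.1)).filter
              (fun x : ℕ × ℕ => x.1 * x.2 ≡ c q [MOD q])) : ℝ) -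
          (#(((boxA N₀ ⌊X⌋₊ j δ ki.1 ki.2) ×ˢ (boxB N₀ ⌊X⌋₊ X δ ki.1)).filter
              (fun x : ℕ × ℕ => (x.1 * x.2).Coprime q)) : ℝ) / (Nat.totient q : ℝ)|) +
      ((j + 1) * (2 * (X / 2 ^ I + δ * X + 1) * (1 + Real.log Q) ^ 2 + 2 * Q) +
        ((⌊X⌋₊ : ℝ) / ((N₀ : ℝ) - 1) * (1 + Real.log Q) + Q * Nat.sqrt ⌊X⌋₊) +
        ((⌊X⌋₊ : ℝ) / ((N₀ : ℝ) - 1) + Nat.sqrt ⌊X⌋₊) * (1 + Real.log Q) ^ 2) := by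
  have hlog : 0 ≤ 1 + Real.log Q := by
    rcases Nat.eq_zero_or_pos Q with h | h
    · rw [h]; simp
    · have : (1 : ℝ) ≤ Q := by exact_mod_cast h
      have := Real.log_nonneg this; linarith
  have hφsum : ∑ q ∈ Finset.Icc 1 Q, (1 : ℝ) / Nat.totient q ≤ (1 + Real.log Q) ^ 2 :=
    sum_Icc_one_div_totient_le_sq Q
  -- Step 1: cell → boxes + boundary pairs + non-squarefree members, for each modulus
  have h1 : ∀ q ∈ Finset.Icc 1 Q,
      |(#((cellΩ N₀ ⌊X⌋₊ (j + 1)).filter (fun b : ℕ => b ≡ c q [MOD q])) : ℝ) -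
          (#((cellΩ N₀ ⌊X⌋₊ (j + 1)).filter (fun b : ℕ => b.Coprime q)) : ℝ) / (Nat.totient q : ℝ)| ≤
        (∑ ki ∈ Finset.range K ×ˢ Finset.range I,
          |(#(((boxA N₀ ⌊X⌋₊ j δ ki.1 ki.2) ×ˢ (boxB N₀ ⌊X⌋₊ X δ ki.1)).filter
                (fun x : ℕ × ℕ => x.1 * x.2 ≡ c q [MOD q])) : ℝ) -
            (#(((boxA N₀ ⌊X⌋₊ j δ ki.1 ki.2) ×ˢ (boxB N₀ ⌊X⌋₊ X δ ki.1)).filter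
                (fun x : ℕ × ℕ => (x.1 * x.2).Coprime q)) : ℝ) / (Nat.totient q : ℝ)|) +
        ((#(((pairs N₀ ⌊X⌋₊ j).filter (restW X δ I)).filter
            (fun x : ℕ × ℕ => x.1 * x.2 ≡ c q [MOD q])) : ℝ) +
          (#((pairs N₀ ⌊X⌋₊ j).filter (restW X δ I)) : ℝ) / (Nat.totient q : ℝ)) +
        (#((Finset.Icc 1 ⌊X⌋₊).filter (fun b : ℕ =>
            ¬ Squarefree b ∧ (∀ p ∈ b.primeFactors, N₀ ≤ p) ∧ b ≡ c q [MOD q])) +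
          (#((Finset.Icc 1 ⌊X⌋₊).filter (fun b : ℕ =>
            ¬ Squarefree b ∧ (∀ p ∈ b.primeFactors, N₀ ≤ p))) : ℝ) / (Nat.totient q : ℝ)) := by
    intro q hq
    have hq0 : 0 < q := (Finset.mem_Icc.1 hq).1
    refine (abs_cellClassDisc_le_abs_pairDisc_add (N₀ := N₀) (T := ⌊X⌋₊) (j := j) hq0 (c q)).trans ?_
    rw [add_assoc]
    refine add_le_add ?_ le_rfl
    rw [pairDisc_eq_sum_boxes_add hX hδ.le K I q (c q)]
    refine (abs_add_le _ _).trans (add_le_add (Finset.abs_sum_le_sum_abs _ _) ?_)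
    exact abs_pairDisc_le_card_add (pairs_sdiff_boxes_subset hX hδ hK I) hq0 (c q)
  refine (Finset.sum_le_sum h1).trans ?_
  rw [Finset.sum_add_distrib, Finset.sum_add_distrib, Finset.sum_add_distrib, Finset.sum_add_distrib,
    Finset.sum_comm]
  -- Step 2: the boundary pairs
  have hA := sum_card_rest_filter_modEq_le (N₀ := N₀) (j := j) hX.le hδ.le I Q c
  have hB : ∑ q ∈ Finset.Icc 1 Q, (#((pairs N₀ ⌊X⌋₊ j).filter (restW X δ I)) : ℝ) / (Nat.totient q : ℝ) ≤
      (j + 1) * (X / 2 ^ I + δ * X + 1) * (1 + Real.log Q) ^ 2 := by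
    have hre : ∀ q ∈ Finset.Icc 1 Q, (#((pairs N₀ ⌊X⌋₊ j).filter (restW X δ I)) : ℝ) / (Nat.totient q : ℝ) =
        (#((pairs N₀ ⌊X⌋₊ j).filter (restW X δ I)) : ℝ) * (1 / Nat.totient q) := fun q _ => by
      rw [mul_one_div]
    rw [Finset.sum_congr rfl hre, ← Finset.mul_sum]
    exact mul_le_mul (card_rest_le hX.le hδ.le I) hφsum
      (Finset.sum_nonneg fun _ _ => by positivity) (by positivity)
  have hj : (0 : ℝ) ≤ j + 1 := by positivity
  have hP0 : 0 ≤ X / 2 ^ I + δ * X + 1 := by positivity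
  have hL1 : 1 + Real.log Q ≤ (1 + Real.log Q) ^ 2 := by
    rcases Nat.eq_zero_or_pos Q with h' | h'
    · rw [h']; simp
    · have : (1 : ℝ) ≤ Q := by exact_mod_cast h'
      have := Real.log_nonneg this
      nlinarith
  have hm' : (j + 1 : ℝ) * ((X / 2 ^ I + δ * X + 1) * (1 + Real.log Q)) ≤
      (j + 1) * ((X / 2 ^ I + δ * X + 1) * (1 + Real.log Q) ^ 2) :=
    mul_le_mul_of_nonneg_left (mul_le_mul_of_nonneg_left hL1 hP0) hj
  -- Step 3: the non-squarefree members
  have hA2 := sum_card_nonSquarefree_rough_modEq_le hN₀ Q hc ⌊X⌋₊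
  have hB2 : ∑ q ∈ Finset.Icc 1 Q, (#((Finset.Icc 1 ⌊X⌋₊).filter (fun b : ℕ =>
      ¬ Squarefree b ∧ (∀ p ∈ b.primeFactors, N₀ ≤ p))) : ℝ) / (Nat.totient q : ℝ) ≤
      ((⌊X⌋₊ : ℝ) / ((N₀ : ℝ) - 1) + Nat.sqrt ⌊X⌋₊) * (1 + Real.log Q) ^ 2 := by
    have hre : ∀ q ∈ Finset.Icc 1 Q, (#((Finset.Icc 1 ⌊X⌋₊).filter (fun b : ℕ =>
        ¬ Squarefree b ∧ (∀ p ∈ b.primeFactors, N₀ ≤ p))) : ℝ) / (Nat.totient q : ℝ) =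
        (#((Finset.Icc 1 ⌊X⌋₊).filter (fun b : ℕ =>
          ¬ Squarefree b ∧ (∀ p ∈ b.primeFactors, N₀ ≤ p))) : ℝ) * (1 / Nat.totient q) := fun q _ => by
      rw [mul_one_div]
    rw [Finset.sum_congr rfl hre, ← Finset.mul_sum]
    have hN : (1 : ℝ) < N₀ := by exact_mod_cast hN₀
    have h0 : 0 ≤ (⌊X⌋₊ : ℝ) / ((N₀ : ℝ) - 1) := div_nonneg (Nat.cast_nonneg _) (by linarith)
    exact mul_le_mul (card_nonSquarefree_rough_le hN₀ ⌊X⌋₊) hφsum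
      (Finset.sum_nonneg fun _ _ => by positivity) (by positivity)
  linarith [hA, hB, hm', hA2, hB2]

end RoughCellsAP

end Literature.NumberTheory.Sieve
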